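import Summits.AtomisticToContinuum.HydrodynamicLimit.Theses.KinematicRung
import Summits.AtomisticToContinuum.HydrodynamicLimit.Theorems.KinematicRungKinematicMeanClosureOnPath
import Summits.AtomisticToContinuum.HydrodynamicLimit.Theorems.RelayRaceLocalityRestartPrincipleMeanOfConjunct
import HarnessLib

/-!
# On-path lemma for the residual conjunct `KinematicMeans`, and the conjunct split of route `KinematicRung`

Route `KinematicRung` decides `HydrodynamicLimit` from its rung `KinematicMeanClosure`
(stmt-AtomisticToContinuum-20153) and the residual conjunct `KinematicMeans` (stmt-20154) by the
gate's `closes`. This file lands the STATEMENT ⇒ RESIDUAL direction the route's thesis announces as a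
support lemma ("the t = 0 uniform-integrability lemma giving S → KinematicMeans"):

* `KinematicMeans_of_MeanHydroLimitInBand` — `KinematicMeans` is the shared item
  `ResponseRigidity.MeanHydroLimitInBand` (stmt-11927) with its energy clause dropped (pure logic);
* `KinematicMeans_of_HydrodynamicLimit : HydrodynamicLimit → KinematicMeans` — composition with the
  landed uniform-integrability theorem
  `Theorems.RestartPrinciple.meanHydroLimitInBand_of_hydrodynamicLimit`
  (`Theorems/RelayRaceLocalityRestartPrincipleMeanOfConjunct.lean`: convergence in probability under
  the local Gibbs laws upgrades to convergence of the means — density by bounded convergence, momentum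
  by the conserved second velocity moment; KipnisLandim1999 App. 1 §8);
* `hydrodynamicLimit_iff_kinematicMeanClosure_and_kinematicMeans` — with the rung's on-path lemma
  `KinematicMeanClosure_of_HydrodynamicLimit` and `closes`, the route is an exact CONJUNCT SPLIT of the
  Statement: `HydrodynamicLimit ↔ KinematicMeanClosure ∧ KinematicMeans` (forward discipline F8: the
  attacked conjunct is the rung, `residual = KinematicMeans`).

No analysis is redone here. prover-fwd2-land-3-0 (on-path lander), 2026-08-18.
-/

namespace Summit.AtomisticToContinuum.HydrodynamicLimit.Theorems

open Summit.AtomisticToContinuum.HydrodynamicLimit.Theses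
open Summit.AtomisticToContinuum.HydrodynamicLimit.Theses.KinematicRung

/-- `KinematicMeans` is `ResponseRigidity.MeanHydroLimitInBand` (mean hydrodynamic limit in the
band: density, momentum AND energy means at every `t < T`) with the energy clause dropped: same
quantifier prefix, conclusion projected to its first two components. -/
theorem KinematicMeans_of_MeanHydroLimitInBand :
    ResponseRigidity.MeanHydroLimitInBand → KinematicMeans := by
  rintro ⟨η, hη, H⟩
  refine ⟨η, hη, fun a₀ θ₀ u₀ ha hθ hu ha0 hθ0 => ?_⟩
  obtain ⟨σ₀, hσ₀, G⟩ := H a₀ θ₀ u₀ ha hθ hu ha0 hθ0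
  exact ⟨σ₀, hσ₀, fun σ hσ hσ' T ρ θ u hsol hpack Φ h0 t ht χ hχ =>
    ⟨(G σ hσ hσ' T ρ θ u hsol hpack Φ h0 t ht χ hχ).1,
      (G σ hσ hσ' T ρ θ u hsol hpack Φ h0 t ht χ hχ).2.1⟩⟩

/-- **On-path lemma for the residual conjunct.** The packing-guarded hydrodynamic limit implies
`KinematicMeans`: convergence in probability of the empirical density and momentum fields under the
transported local Gibbs laws upgrades to convergence of their expectations (uniform integrability:
`|n_N[χ]| ≤ sup|χ|`; `(m_N[χ]_j)² ≤ (sup|χ|)²·(N+1)⁻¹∑‖vᵢ(t)‖²` with the mean squared speed conserved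
by the hard-sphere flow and bounded at time `0` by the Gaussian statics), which is the landed
`RestartPrinciple.meanHydroLimitInBand_of_hydrodynamicLimit`; then drop the energy clause.
[cite: KipnisLandim1999, App. 1 §8] -/
theorem KinematicMeans_of_HydrodynamicLimit : _root_.HydrodynamicLimit → KinematicMeans :=
  fun h => KinematicMeans_of_MeanHydroLimitInBand
    (RestartPrinciple.meanHydroLimitInBand_of_hydrodynamicLimit h)

/-- **Route `KinematicRung` is an exact conjunct split of the Statement.**
`HydrodynamicLimit ↔ KinematicMeanClosure ∧ KinematicMeans`: (→) by the two on-path lemmas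
`KinematicMeanClosure_of_HydrodynamicLimit`, `KinematicMeans_of_HydrodynamicLimit`; (←) by the
route's deciding theorem `KinematicRung.closes`. -/
theorem hydrodynamicLimit_iff_kinematicMeanClosure_and_kinematicMeans :
    _root_.HydrodynamicLimit ↔ KinematicMeanClosure ∧ KinematicMeans :=
  ⟨fun h => ⟨KinematicMeanClosure_of_HydrodynamicLimit h, KinematicMeans_of_HydrodynamicLimit h⟩,
    fun h => closes h.1 h.2⟩

end Summit.AtomisticToContinuum.HydrodynamicLimit.Theorems
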